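import Summits.QuantumFields.BalabanUV.T4Continuum.Spine.NE1p.TiltedMeanSmoothDual

/-!
# T⁴ programme, spine estimate NE1′ (node O3b/H2) — THE SMOOTH-DUAL CURRENCY UNDER A NONLINEAR TRANSFER: the first-order channel is
# the product of TWO flatness factors (criticality of the test function × fibrewise mean DISPLACEMENT discrepancy), and centred fibres
# do NOT centre a nonlinear displacement

Cell `pub-balaban-gaps` (YM blitz Y1, track G2), seat `ne1` gen 7 (prover-pub-balaban-gaps-ne1-g7-0), record `HOME/ne/NE1.md` §4 rows
R46–R47 (gen 7).  ADDITIVE — imports the seat's gen-6 `TiltedMeanSmoothDual` (p352607 ✓) ONLY and uses none of its declarations in the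
proofs (§2 re-proves the fibred swap in the general form from which gen 6's `abs_fibred_swap_le` descends); modifies nothing.  Sibling
(same generation): `TiltedMeanSmoothDualCriticalTilt` (the tilt family inherits the loop's criticality; the per-slot influence on the
TILTED MEAN with both flatness factors; the letter `θ₁φΛ`), `TiltedMeanSmoothDualSymmetry` (displacement-centring as a kernel join).

WHY (gen 7 = an audit of gen 6's currency against the NONLINEARITY of the block averaging).  Gen 6 modelled the slot's transfer to the
unit field ADDITIVELY, `x = m u + θ·ℓ v` ([B7] (10) linearised), and found: first order × {fibrewise conditional-mean discrepancy of the
LINEAR image `ℓ v`} + second order, «the nonlinearity of Bałaban's averaging adds a remainder of the same second order, NOT modelled».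
That last clause is examined here and found to need a located input.  The `(K−j)`-fold composed averaging `Φ` has, with respect to one
scale-`j` variable, a SECOND derivative of the same size as its first (`(f∘F)'' ∋ f'·F''`: curvature is transported linearly, one factor
`θ₁` per level, exactly like the gradient), so the displacement `d = Φ(u,v) − Φ(u,v₀) = θ·ℓ v + r(u,v)` carries a curvature part
`|r| ≤ θ₂·q v` with `θ₂` of FIRST order in the transfer rate — second order in the SLOT VARIABLE (which is what «the same second order»
can only mean: it is the `g'·Φ_vv` part of `(g∘Φ)_vv`, cf. Chatterjee's generalised Lindeberg principle for smooth functions of the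
variables) but FIRST order in the AGE `K − j`, and the ledger's slice sums count the age —; a fibre law centred in `v`
(`Σ_v (κB − κA) ℓ v = 0`) leaves the fibre mean of `d` displaced by `θ₂·(second-moment discrepancy)`, and the swap tested on a function of
slope `G₁` moves by `G₁·θ₂·Q` — first order in the age, with no small factor (§3 `abs_fibred_swap_le_of_centred_of_deriv_bound`;
ATTAINED: §4 `centredPair_nonlinear_swap_id`).  In the b2b cell's catalogue this is the `dW·Φ_vv` half of the located obligation (γ)
«the diagonal second-order (Hessian-trace) part» (`t4/T4-EST-O3Ei1.md`, [NE1-G2-XREF-NE7]), which the linearisation dropped; the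
`d²W(Φ_v, Φ_v)` half is genuinely second order in the age and sits in `G₂`.  What
closes it is EITHER the correct form of the symmetry input — centring of the DISPLACEMENT `Φ u v − m u`, not of the slot variable (§2
keeps the displacement general; in the gauge setting conjugation symmetry centres it at flat exteriors to ALL orders, see below) — OR the
OTHER factor of NE1.md R28 (2): CRITICALITY of the loop observable at flat holonomy (`dW(1) = 0`; ne7's `Spine.NE7.ReTrCrit`, kernel
`reTrCrit_specialUnitaryGroup`) — the test function's slope at the exterior's unit field is itself a flatness factor,
`|g'(m u)| ≤ G₂·|m u − x₀ u|` (§1).  Both hold for a loop, so the first-order channel is a product of TWO flatness factors.  This file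
proves, at [folklore] level:
* §1 CRITICALITY, scalar shape: `g'` `G₂`-Lipschitz with `g'(x₀) = 0` ⇒ `|g'(x)| ≤ G₂|x − x₀|` (`abs_deriv_le_of_critical`) and
  `|g(x) − g(x₀)| ≤ G₂(x − x₀)²` (`abs_sub_le_sq_of_critical` — the scalar form of `ReTrCrit`); `|g''| ≤ G₂` ⇒ `g'` `G₂`-Lipschitz
  (`abs_deriv_sub_le_of_deriv_two_bound`).
* §2 THE FIBRED SWAP FOR A GENERAL (NONLINEAR) TRANSFER WITH A POINTWISE FIRST-ORDER WEIGHT (`abs_fibred_swap_le_pointwise`):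
  exterior `u` with weights `ν`, fibre kernels `κA u ·` ∕ `κB u ·` depending arbitrarily on `u` with equal fibre masses, unit field
  `Φ u v` ARBITRARY, reference level `m u` arbitrary, test function with Taylor majorant `G₂` and NO bound on `g'`:
  `|Σ_u ν_u Σ_v (κB − κA)·g(Φ u v)| ≤ Σ_u ν_u·|g'(m u)|·|Σ_v (κB − κA)(Φ u v − m u)| + G₂·Σ_u ν_u Σ_v (κA + κB)(Φ u v − m u)²`;
  with `|g'| ≤ G₁` this is gen 6's shape for a general displacement (`abs_fibred_swap_le_of_deriv_bound`); with criticality it is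
  **`abs_fibred_swap_le_of_critical`**: first-order channel `≤ G₂·Σ_u ν_u·|m u − x₀ u|·|Σ_v (κB − κA)(Φ u v − m u)|` — the PRODUCT OF
  TWO FACTORS EACH VANISHING ON THE FLAT ORBIT (R28 (2) verbatim, as a theorem of the finite model) — plus second order.
* §3 THE NONLINEARITY LOCATED: `Φ u v − m u = θ·ℓ v + r u v`, `|r u v| ≤ θ₂·q v` ⇒ the displacement discrepancy is
  `≤ |θ|·|Σ_v (κB − κA) ℓ v| + θ₂·Σ_v (κA + κB) q v` (`abs_flat_displacement_le`); centred fibres kill the first summand only;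
  WITHOUT criticality the swap is `≤ G₁θ₂·Q + G₂·M₂` (first order in `θ₂`, `abs_fibred_swap_le_of_centred_of_deriv_bound`), WITH it
  `≤ G₂θ₂·Σ_u ν_u |m u − x₀ u|·Q_u + G₂·M₂` (`abs_fibred_swap_le_of_centred_of_critical`): first order × exterior flatness + second order.
* §4 WITNESSES (one exterior, off `δ_{v=0}`, on `½δ_h + ½δ_{−h}` — centred —, transfer `m + θv + θ₂v²`): tested on the identity
  (slope 1, Taylor majorant 0, critical nowhere) the swap is EXACTLY `θ₂h²` (`centredPair_nonlinear_swap_id`: §3's bound without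
  criticality is attained, and no matched first moment removes it); tested on `(x − m)²` (critical at the exterior's level) it is
  `θ²h² + θ₂²h⁴` (`centredPair_nonlinear_swap_sq`): second order in `(θ, θ₂)`.
CONSEQUENCE FOR THE ROW (NE1.md v7 §0 l.13).  The located per-slot inputs of the old-slot budget in the smooth-dual currency now read:
transfer rate `θ₁^{K−j}` for BOTH the gradient and the curvature of the composed averaging ([B7] (10), [B11] (8) KIND), the fibrewise
mean-DISPLACEMENT discrepancy (in the gauge setting: zero at flat exteriors to ALL orders in the nonlinearity, because the unit-lattice
displacement is conjugation-equivariant in the slot variable and its 𝔤-valued logarithm has an Ad-invariant — hence vanishing — mean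
under a conjugation-invariant fibre law — `T4AdInvariant`; a kernel JOIN for one fibre at the measure level in the second sibling
`TiltedMeanSmoothDualSymmetry`, modulo the tree's open shape (α)), CRITICALITY of the loop (kernel, ne7), and `C²` of the loop (free).
«Centred in the slot variable» is NOT sufficient under a nonlinear transfer; «centred displacement» or «critical test function at a flat
exterior» is — and off the flat orbit the first-order channel carries the product of the two flatness factors, priced at the ledger level
in the sibling (letter `θ₁φΛ = L⁻¹` in `d = 4` next to `θ₁²Λ = L⁻²`).  Classification of NE1′ UNCHANGED: WORK-bound ∕ OBJECT-bound ∕ NOT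
idea-bound; one input of R42 re-located (from «same second order, not modelled» to «first order × two flatness factors, modelled»).

HONEST FRAMING.  [folklore] calculus (mean value inequality) and finite-sum bookkeeping over ABSTRACT data; the fibred finite model is a
MODEL of one slot (dependent, nonlinear transfer to ONE unit-field coordinate), NOT Bałaban's class-conditioned law; nothing of his is
asserted or instantiated; the sizes `θ₂ ≍ θ₁^{K−j}` and the symmetry∕criticality readings above are this seat's, quoted for orientation,
not certified here.  NE1′ NOT proved; spine 0∕9; (B) 0∕13; one fixed finite T⁴ — NOT ℝ⁴, NOT infinite volume, NOT a mass gap, NOT Clay.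
0 sorry.
-/

noncomputable section

open Finset
open scoped BigOperators

namespace Summit.QuantumFields.BalabanUV.T4Continuum.NE1p.TiltedMeanSmoothDualCritical

/-! ## §1 Criticality, scalar shape: a test function critical at `x₀` has a first derivative that is itself a flatness factor -/

section Critical

variable {g g' g'' : ℝ → ℝ} {G₂ : ℝ}

/-- **CRITICALITY ⇒ THE SLOPE IS A FLATNESS FACTOR.**  If `g'` is `G₂`-Lipschitz and vanishes at `x₀`, then `|g'(x)| ≤ G₂·|x − x₀|`
for every `x` (in the application: `x₀` = the unit-field value of a FLAT exterior, where the loop observable is critical —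
`dW(1) = 0`, ne7's `Spine.NE7.ReTrCrit`; `|x − x₀|` = the exterior's distance from the flat orbit). [folklore] -/
theorem abs_deriv_le_of_critical (hg' : ∀ x y, |g' x - g' y| ≤ G₂ * |x - y|) {x₀ : ℝ} (h0 : g' x₀ = 0) (x : ℝ) :
    |g' x| ≤ G₂ * |x - x₀| := by
  simpa only [h0, sub_zero] using hg' x x₀

/-- … and the function itself is quadratically flat there: `|g(x) − g(x₀)| ≤ G₂·(x − x₀)²` from a Taylor majorant `G₂` and
`g'(x₀) = 0` — the scalar shape of ne7's `ReTrCrit G Cc` («`1 − Re tr g ≤ Cc·dist(g,1)²`»). [folklore] -/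
theorem abs_sub_le_sq_of_critical (hg : ∀ x h : ℝ, |g (x + h) - g x - h * g' x| ≤ G₂ * h ^ 2) {x₀ : ℝ} (h0 : g' x₀ = 0)
    (x : ℝ) : |g x - g x₀| ≤ G₂ * (x - x₀) ^ 2 := by
  have h := hg x₀ (x - x₀)
  rwa [h0, mul_zero, sub_zero, add_sub_cancel] at h

/-- A bounded second derivative makes the first derivative Lipschitz: `|g''| ≤ G₂` ⇒ `|g'(x) − g'(y)| ≤ G₂·|x − y|` (mean value
inequality on `univ`; the step used inside gen 6's `taylor_two_of_deriv_two_bound`, exported for §2's criticality hypothesis).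
[folklore] -/
theorem abs_deriv_sub_le_of_deriv_two_bound (hg' : ∀ x, HasDerivAt g' (g'' x) x) (hG₂ : ∀ x, |g'' x| ≤ G₂) (x y : ℝ) :
    |g' x - g' y| ≤ G₂ * |x - y| := by
  have hxy := convex_univ.norm_image_sub_le_of_norm_hasDerivWithin_le (f := g') (f' := g'') (C := G₂)
    (fun z _ => (hg' z).hasDerivWithinAt) (fun z _ => by rw [Real.norm_eq_abs]; exact hG₂ z)
    (Set.mem_univ y) (Set.mem_univ x)
  simpa only [Real.norm_eq_abs] using hxy

end Critical

/-! ## §2 The fibred swap under a GENERAL transfer, with the first-order weight kept pointwise in the exterior -/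

section Swap

variable {U V : Type*} {EU : Finset U} {EV : Finset V} {ν : U → ℝ} {κA κB : U → V → ℝ} {Φ : U → V → ℝ} {m x₀ : U → ℝ}
  {g g' : ℝ → ℝ} {G₁ G₂ : ℝ}

/-- **THE FIBRED SLOT SWAP, GENERAL TRANSFER, POINTWISE FIRST-ORDER WEIGHT.**  Finite model of ONE slot of a class law seen from the unit
lattice: exterior configurations `u ∈ EU` with weights `ν u ≥ 0`, slot values `v ∈ EV` drawn from a kernel `κA u ·` (off) or `κB u ·`
(on) — both depending on the exterior ARBITRARILY, with equal fibre masses ([B15] (0.4) fibrewise) —, unit-field value `Φ u v`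
ARBITRARY (the composed block averaging is NONLINEAR in the slot variable), reference level `m u` arbitrary (the fibre's unit field with
the slot at rest, say), test function `g` with second-order Taylor majorant `G₂` and NO bound assumed on `g'`:
`|Σ_u ν_u Σ_v (κB − κA)(u,v)·g(Φ u v)| ≤ Σ_u ν_u·|g'(m u)|·|Σ_v (κB − κA)(u,v)·(Φ u v − m u)| + G₂·Σ_u ν_u Σ_v (κA + κB)(u,v)·(Φ u v − m u)²`.
First term = (slope of the test function AT THE EXTERIOR'S LEVEL) × (fibrewise mean-DISPLACEMENT discrepancy); second = second order in
the displacement.  Gen 6's `TiltedMeanSmoothDual.abs_fibred_swap_le` is the case `Φ u v = m u + θ·ℓ v`, `|g'| ≤ G₁`.  NO smoothness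
of any law, NO independence of slot and exterior, NO expansion. [folklore] -/
theorem abs_fibred_swap_le_pointwise (hν : ∀ u ∈ EU, 0 ≤ ν u) (hκA : ∀ u ∈ EU, ∀ v ∈ EV, 0 ≤ κA u v)
    (hκB : ∀ u ∈ EU, ∀ v ∈ EV, 0 ≤ κB u v) (hmass : ∀ u ∈ EU, ∑ v ∈ EV, κA u v = ∑ v ∈ EV, κB u v)
    (hg : ∀ x h : ℝ, |g (x + h) - g x - h * g' x| ≤ G₂ * h ^ 2) :
    |∑ u ∈ EU, ν u * ∑ v ∈ EV, (κB u v - κA u v) * g (Φ u v)|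
      ≤ ∑ u ∈ EU, ν u * (|g' (m u)| * |∑ v ∈ EV, (κB u v - κA u v) * (Φ u v - m u)|)
        + G₂ * ∑ u ∈ EU, ν u * ∑ v ∈ EV, (κA u v + κB u v) * (Φ u v - m u) ^ 2 := by
  -- one fibre
  have hfib : ∀ u ∈ EU, |∑ v ∈ EV, (κB u v - κA u v) * g (Φ u v)|
      ≤ |g' (m u)| * |∑ v ∈ EV, (κB u v - κA u v) * (Φ u v - m u)|
        + G₂ * ∑ v ∈ EV, (κA u v + κB u v) * (Φ u v - m u) ^ 2 := by
    intro u hu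
    set R : V → ℝ := fun v => g (Φ u v) - g (m u) - (Φ u v - m u) * g' (m u) with hR
    have hRb : ∀ v, |R v| ≤ G₂ * (Φ u v - m u) ^ 2 := by
      intro v
      have h := hg (m u) (Φ u v - m u)
      rwa [add_sub_cancel] at h
    have hsplit : ∑ v ∈ EV, (κB u v - κA u v) * g (Φ u v)
        = g (m u) * (∑ v ∈ EV, κB u v - ∑ v ∈ EV, κA u v)
          + g' (m u) * ∑ v ∈ EV, (κB u v - κA u v) * (Φ u v - m u)
          + ∑ v ∈ EV, (κB u v - κA u v) * R v := by
      rw [← sum_sub_distrib, mul_sum, mul_sum, ← sum_add_distrib, ← sum_add_distrib]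
      refine sum_congr rfl fun v _ => ?_
      simp only [hR]
      ring
    rw [hsplit, ← hmass u hu, sub_self, mul_zero, zero_add]
    calc |g' (m u) * ∑ v ∈ EV, (κB u v - κA u v) * (Φ u v - m u) + ∑ v ∈ EV, (κB u v - κA u v) * R v|
        ≤ |g' (m u) * ∑ v ∈ EV, (κB u v - κA u v) * (Φ u v - m u)| + |∑ v ∈ EV, (κB u v - κA u v) * R v| :=
          abs_add_le _ _
      _ ≤ |g' (m u)| * |∑ v ∈ EV, (κB u v - κA u v) * (Φ u v - m u)|
          + ∑ v ∈ EV, (κA u v + κB u v) * (G₂ * (Φ u v - m u) ^ 2) := by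
          rw [abs_mul]
          refine add_le_add le_rfl ((abs_sum_le_sum_abs _ _).trans (sum_le_sum fun v hv => ?_))
          rw [abs_mul]
          refine mul_le_mul ?_ (hRb v) (abs_nonneg _) (add_nonneg (hκA u hu v hv) (hκB u hu v hv))
          have hA := hκA u hu v hv
          have hB := hκB u hu v hv
          rw [abs_le]; constructor <;> linarith
      _ = |g' (m u)| * |∑ v ∈ EV, (κB u v - κA u v) * (Φ u v - m u)|
          + G₂ * ∑ v ∈ EV, (κA u v + κB u v) * (Φ u v - m u) ^ 2 := by
          congr 1
          rw [mul_sum]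
          refine sum_congr rfl fun v _ => ?_
          ring
  -- sum over the fibres
  calc |∑ u ∈ EU, ν u * ∑ v ∈ EV, (κB u v - κA u v) * g (Φ u v)|
      ≤ ∑ u ∈ EU, |ν u * ∑ v ∈ EV, (κB u v - κA u v) * g (Φ u v)| := abs_sum_le_sum_abs _ _
    _ = ∑ u ∈ EU, ν u * |∑ v ∈ EV, (κB u v - κA u v) * g (Φ u v)| :=
        sum_congr rfl fun u hu => by rw [abs_mul, abs_of_nonneg (hν u hu)]
    _ ≤ ∑ u ∈ EU, ν u * (|g' (m u)| * |∑ v ∈ EV, (κB u v - κA u v) * (Φ u v - m u)|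
          + G₂ * ∑ v ∈ EV, (κA u v + κB u v) * (Φ u v - m u) ^ 2) :=
        sum_le_sum fun u hu => mul_le_mul_of_nonneg_left (hfib u hu) (hν u hu)
    _ = ∑ u ∈ EU, ν u * (|g' (m u)| * |∑ v ∈ EV, (κB u v - κA u v) * (Φ u v - m u)|)
          + G₂ * ∑ u ∈ EU, ν u * ∑ v ∈ EV, (κA u v + κB u v) * (Φ u v - m u) ^ 2 := by
        rw [mul_sum, ← sum_add_distrib]
        refine sum_congr rfl fun u _ => ?_
        ring

/-- Gen 6's shape for a GENERAL displacement: with `|g'| ≤ G₁` the first-order channel is `G₁·Σ_u ν_u·|Σ_v (κB − κA)(Φ u v − m u)|` —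
the fibrewise mean-displacement discrepancy (NOT the discrepancy of a linear image: under a nonlinear transfer the two differ by the
curvature term of §3). [folklore] -/
theorem abs_fibred_swap_le_of_deriv_bound (hν : ∀ u ∈ EU, 0 ≤ ν u) (hκA : ∀ u ∈ EU, ∀ v ∈ EV, 0 ≤ κA u v)
    (hκB : ∀ u ∈ EU, ∀ v ∈ EV, 0 ≤ κB u v) (hmass : ∀ u ∈ EU, ∑ v ∈ EV, κA u v = ∑ v ∈ EV, κB u v)
    (hg : ∀ x h : ℝ, |g (x + h) - g x - h * g' x| ≤ G₂ * h ^ 2) (hg' : ∀ x, |g' x| ≤ G₁) :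
    |∑ u ∈ EU, ν u * ∑ v ∈ EV, (κB u v - κA u v) * g (Φ u v)|
      ≤ G₁ * ∑ u ∈ EU, ν u * |∑ v ∈ EV, (κB u v - κA u v) * (Φ u v - m u)|
        + G₂ * ∑ u ∈ EU, ν u * ∑ v ∈ EV, (κA u v + κB u v) * (Φ u v - m u) ^ 2 := by
  refine (abs_fibred_swap_le_pointwise (Φ := Φ) (m := m) hν hκA hκB hmass hg).trans (add_le_add ?_ le_rfl)
  rw [mul_sum]
  refine sum_le_sum fun u hu => ?_
  calc ν u * (|g' (m u)| * |∑ v ∈ EV, (κB u v - κA u v) * (Φ u v - m u)|)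
      ≤ ν u * (G₁ * |∑ v ∈ EV, (κB u v - κA u v) * (Φ u v - m u)|) :=
        mul_le_mul_of_nonneg_left (mul_le_mul_of_nonneg_right (hg' _) (abs_nonneg _)) (hν u hu)
    _ = G₁ * (ν u * |∑ v ∈ EV, (κB u v - κA u v) * (Φ u v - m u)|) := by ring

/-- **CRITICALITY × FLATNESS: THE FIRST-ORDER CHANNEL IS A PRODUCT OF TWO FACTORS EACH VANISHING ON THE FLAT ORBIT.**  If the test
function is critical at the flat level of each fibre — `g'(x₀ u) = 0` with `g'` `G₂`-Lipschitz (for the tilt family: the loop's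
criticality at flat holonomy, sibling §1) — then
`|Σ_u ν_u Σ_v (κB − κA)·g(Φ u v)| ≤ G₂·Σ_u ν_u·|m u − x₀ u|·|Σ_v (κB − κA)(Φ u v − m u)| + G₂·Σ_u ν_u Σ_v (κA + κB)(Φ u v − m u)²`:
(exterior's distance from the flat orbit) × (fibrewise mean-displacement discrepancy, itself zero at flat exteriors by symmetry) +
second order — NE1.md R28 (2) («the channel ⟨a(U), m_j(U)⟩ is a product of two factors each vanishing on the flat orbit: a by
criticality of W at hol = 1, m_j by conjugation symmetry») as a theorem of the finite model.  ONE constant `G₂` serves both terms.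
[folklore] -/
theorem abs_fibred_swap_le_of_critical (hν : ∀ u ∈ EU, 0 ≤ ν u) (hκA : ∀ u ∈ EU, ∀ v ∈ EV, 0 ≤ κA u v)
    (hκB : ∀ u ∈ EU, ∀ v ∈ EV, 0 ≤ κB u v) (hmass : ∀ u ∈ EU, ∑ v ∈ EV, κA u v = ∑ v ∈ EV, κB u v)
    (hg : ∀ x h : ℝ, |g (x + h) - g x - h * g' x| ≤ G₂ * h ^ 2) (hg'L : ∀ x y, |g' x - g' y| ≤ G₂ * |x - y|)
    (hcrit : ∀ u ∈ EU, g' (x₀ u) = 0) :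
    |∑ u ∈ EU, ν u * ∑ v ∈ EV, (κB u v - κA u v) * g (Φ u v)|
      ≤ G₂ * ∑ u ∈ EU, ν u * (|m u - x₀ u| * |∑ v ∈ EV, (κB u v - κA u v) * (Φ u v - m u)|)
        + G₂ * ∑ u ∈ EU, ν u * ∑ v ∈ EV, (κA u v + κB u v) * (Φ u v - m u) ^ 2 := by
  refine (abs_fibred_swap_le_pointwise (Φ := Φ) (m := m) hν hκA hκB hmass hg).trans (add_le_add ?_ le_rfl)
  rw [mul_sum]
  refine sum_le_sum fun u hu => ?_
  calc ν u * (|g' (m u)| * |∑ v ∈ EV, (κB u v - κA u v) * (Φ u v - m u)|)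
      ≤ ν u * (G₂ * |m u - x₀ u| * |∑ v ∈ EV, (κB u v - κA u v) * (Φ u v - m u)|) :=
        mul_le_mul_of_nonneg_left
          (mul_le_mul_of_nonneg_right (abs_deriv_le_of_critical hg'L (hcrit u hu) (m u)) (abs_nonneg _)) (hν u hu)
    _ = G₂ * (ν u * (|m u - x₀ u| * |∑ v ∈ EV, (κB u v - κA u v) * (Φ u v - m u)|)) := by ring

end Swap

/-! ## §3 The nonlinearity located: centred fibres do not centre the displacement; criticality (or a matched second moment) is needed -/

section Nonlinear

variable {U V : Type*} {EU : Finset U} {EV : Finset V} {ν : U → ℝ} {κA κB : U → V → ℝ} {Φ : U → V → ℝ} {m x₀ : U → ℝ}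
  {r : U → V → ℝ} {ℓ q : V → ℝ} {θ θ₂ : ℝ} {g g' : ℝ → ℝ} {G₁ G₂ : ℝ}

/-- **THE DISPLACEMENT DISCREPANCY SPLITS INTO A LINEAR AND A CURVATURE PART.**  If the displacement is `Φ u v − m u = θ·ℓ v + r u v`
(linear image transferred with rate `θ`, plus a nonlinear remainder) with `|r u v| ≤ θ₂·q v` (`q ≥ 0` a quadratic size; for the
`(K−j)`-fold composed averaging `θ₂ ≍ θ ≍ θ₁^{K−j}` — curvature is transported like the gradient), then on each fibre
`|Σ_v (κB − κA)(Φ u v − m u)| ≤ |θ|·|Σ_v (κB − κA) ℓ v| + θ₂·Σ_v (κA + κB) q v`.  A fibre law centred in the LINEAR image kills the first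
summand only; the second is (curvature) × (second-moment content), small only if the two fibre laws' `q`-moments also match. [folklore] -/
theorem abs_flat_displacement_le (hκA : ∀ u ∈ EU, ∀ v ∈ EV, 0 ≤ κA u v) (hκB : ∀ u ∈ EU, ∀ v ∈ EV, 0 ≤ κB u v)
    (hΦ : ∀ u ∈ EU, ∀ v ∈ EV, Φ u v - m u = θ * ℓ v + r u v) (hr : ∀ u ∈ EU, ∀ v ∈ EV, |r u v| ≤ θ₂ * q v)
    {u : U} (hu : u ∈ EU) :
    |∑ v ∈ EV, (κB u v - κA u v) * (Φ u v - m u)|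
      ≤ |θ| * |∑ v ∈ EV, (κB u v - κA u v) * ℓ v| + θ₂ * ∑ v ∈ EV, (κA u v + κB u v) * q v := by
  have hsplit : ∑ v ∈ EV, (κB u v - κA u v) * (Φ u v - m u)
      = θ * ∑ v ∈ EV, (κB u v - κA u v) * ℓ v + ∑ v ∈ EV, (κB u v - κA u v) * r u v := by
    rw [mul_sum, ← sum_add_distrib]
    refine sum_congr rfl fun v hv => ?_
    rw [hΦ u hu v hv]
    ring
  rw [hsplit]
  calc |θ * ∑ v ∈ EV, (κB u v - κA u v) * ℓ v + ∑ v ∈ EV, (κB u v - κA u v) * r u v|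
      ≤ |θ * ∑ v ∈ EV, (κB u v - κA u v) * ℓ v| + |∑ v ∈ EV, (κB u v - κA u v) * r u v| := abs_add_le _ _
    _ ≤ |θ| * |∑ v ∈ EV, (κB u v - κA u v) * ℓ v| + ∑ v ∈ EV, (κA u v + κB u v) * (θ₂ * q v) := by
        rw [abs_mul]
        refine add_le_add le_rfl ((abs_sum_le_sum_abs _ _).trans (sum_le_sum fun v hv => ?_))
        rw [abs_mul]
        refine mul_le_mul ?_ (hr u hu v hv) (abs_nonneg _) (add_nonneg (hκA u hu v hv) (hκB u hu v hv))
        have hA := hκA u hu v hv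
        have hB := hκB u hu v hv
        rw [abs_le]; constructor <;> linarith
    _ = |θ| * |∑ v ∈ EV, (κB u v - κA u v) * ℓ v| + θ₂ * ∑ v ∈ EV, (κA u v + κB u v) * q v := by
        congr 1
        rw [mul_sum]
        exact sum_congr rfl fun v _ => by ring

/-- **WITHOUT CRITICALITY, CENTRED FIBRES LEAVE A FIRST-ORDER TERM IN THE CURVATURE.**  Fibres centred in the linear image
(`Σ_v κA ℓ = Σ_v κB ℓ`), `|g'| ≤ G₁`, Taylor majorant `G₂`:
`|swap| ≤ G₁·θ₂·Σ_u ν_u Σ_v (κA + κB) q v + G₂·Σ_u ν_u Σ_v (κA + κB)(Φ u v − m u)²` — the first summand is FIRST order in `θ₂ ≍ θ₁^{K−j}`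
and carries NO small factor: gen 6's «remainder of the same second order» needs an input (§4: attained). [folklore] -/
theorem abs_fibred_swap_le_of_centred_of_deriv_bound (hν : ∀ u ∈ EU, 0 ≤ ν u) (hκA : ∀ u ∈ EU, ∀ v ∈ EV, 0 ≤ κA u v)
    (hκB : ∀ u ∈ EU, ∀ v ∈ EV, 0 ≤ κB u v) (hmass : ∀ u ∈ EU, ∑ v ∈ EV, κA u v = ∑ v ∈ EV, κB u v)
    (hmean : ∀ u ∈ EU, ∑ v ∈ EV, κA u v * ℓ v = ∑ v ∈ EV, κB u v * ℓ v)
    (hΦ : ∀ u ∈ EU, ∀ v ∈ EV, Φ u v - m u = θ * ℓ v + r u v) (hr : ∀ u ∈ EU, ∀ v ∈ EV, |r u v| ≤ θ₂ * q v)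
    (hg : ∀ x h : ℝ, |g (x + h) - g x - h * g' x| ≤ G₂ * h ^ 2) (hg' : ∀ x, |g' x| ≤ G₁) :
    |∑ u ∈ EU, ν u * ∑ v ∈ EV, (κB u v - κA u v) * g (Φ u v)|
      ≤ G₁ * θ₂ * ∑ u ∈ EU, ν u * ∑ v ∈ EV, (κA u v + κB u v) * q v
        + G₂ * ∑ u ∈ EU, ν u * ∑ v ∈ EV, (κA u v + κB u v) * (Φ u v - m u) ^ 2 := by
  have hG₁ : 0 ≤ G₁ := (abs_nonneg _).trans (hg' 0)
  refine (abs_fibred_swap_le_of_deriv_bound (Φ := Φ) (m := m) hν hκA hκB hmass hg hg').trans (add_le_add ?_ le_rfl)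
  rw [mul_assoc, mul_sum, mul_sum, ← mul_sum]
  refine mul_le_mul_of_nonneg_left (sum_le_sum fun u hu => ?_) hG₁
  have hcen : ∑ v ∈ EV, (κB u v - κA u v) * ℓ v = 0 := by
    simp only [sub_mul, sum_sub_distrib, hmean u hu, sub_self]
  have h := abs_flat_displacement_le (Φ := Φ) (m := m) hκA hκB hΦ hr hu
  rw [hcen, abs_zero, mul_zero, zero_add] at h
  calc ν u * |∑ v ∈ EV, (κB u v - κA u v) * (Φ u v - m u)|
      ≤ ν u * (θ₂ * ∑ v ∈ EV, (κA u v + κB u v) * q v) := mul_le_mul_of_nonneg_left h (hν u hu)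
    _ = θ₂ * (ν u * ∑ v ∈ EV, (κA u v + κB u v) * q v) := by ring

/-- **WITH CRITICALITY, THE CURVATURE TERM CARRIES THE EXTERIOR'S FLATNESS FACTOR.**  Fibres centred in the linear image, test function
critical at the flat level `x₀ u` of each fibre with `g'` `G₂`-Lipschitz:
`|swap| ≤ G₂·θ₂·Σ_u ν_u·|m u − x₀ u|·Σ_v (κA + κB) q v + G₂·Σ_u ν_u Σ_v (κA + κB)(Φ u v − m u)²` — first order in the curvature × the
exterior's distance from the flat orbit, plus second order.  In the gauge setting the mean displacement is centred at flat exteriors to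
all orders (the curvature term's fibre mean is an Ad-invariant vector, `T4AdInvariant`), so BOTH factors vanish on the flat orbit.
[folklore] -/
theorem abs_fibred_swap_le_of_centred_of_critical (hν : ∀ u ∈ EU, 0 ≤ ν u) (hκA : ∀ u ∈ EU, ∀ v ∈ EV, 0 ≤ κA u v)
    (hκB : ∀ u ∈ EU, ∀ v ∈ EV, 0 ≤ κB u v) (hmass : ∀ u ∈ EU, ∑ v ∈ EV, κA u v = ∑ v ∈ EV, κB u v)
    (hmean : ∀ u ∈ EU, ∑ v ∈ EV, κA u v * ℓ v = ∑ v ∈ EV, κB u v * ℓ v)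
    (hΦ : ∀ u ∈ EU, ∀ v ∈ EV, Φ u v - m u = θ * ℓ v + r u v) (hr : ∀ u ∈ EU, ∀ v ∈ EV, |r u v| ≤ θ₂ * q v)
    (hg : ∀ x h : ℝ, |g (x + h) - g x - h * g' x| ≤ G₂ * h ^ 2) (hg'L : ∀ x y, |g' x - g' y| ≤ G₂ * |x - y|)
    (hcrit : ∀ u ∈ EU, g' (x₀ u) = 0) :
    |∑ u ∈ EU, ν u * ∑ v ∈ EV, (κB u v - κA u v) * g (Φ u v)|
      ≤ G₂ * θ₂ * ∑ u ∈ EU, ν u * (|m u - x₀ u| * ∑ v ∈ EV, (κA u v + κB u v) * q v)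
        + G₂ * ∑ u ∈ EU, ν u * ∑ v ∈ EV, (κA u v + κB u v) * (Φ u v - m u) ^ 2 := by
  have hG₂ : 0 ≤ G₂ := by
    have h1 := hg'L 1 0
    rw [sub_zero, abs_one, mul_one] at h1
    exact (abs_nonneg _).trans h1
  refine (abs_fibred_swap_le_of_critical (Φ := Φ) (m := m) hν hκA hκB hmass hg hg'L hcrit).trans (add_le_add ?_ le_rfl)
  rw [mul_assoc, mul_sum, mul_sum, ← mul_sum]
  refine mul_le_mul_of_nonneg_left (sum_le_sum fun u hu => ?_) hG₂
  have hcen : ∑ v ∈ EV, (κB u v - κA u v) * ℓ v = 0 := by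
    simp only [sub_mul, sum_sub_distrib, hmean u hu, sub_self]
  have h := abs_flat_displacement_le (Φ := Φ) (m := m) hκA hκB hΦ hr hu
  rw [hcen, abs_zero, mul_zero, zero_add] at h
  calc ν u * (|m u - x₀ u| * |∑ v ∈ EV, (κB u v - κA u v) * (Φ u v - m u)|)
      ≤ ν u * (|m u - x₀ u| * (θ₂ * ∑ v ∈ EV, (κA u v + κB u v) * q v)) :=
        mul_le_mul_of_nonneg_left (mul_le_mul_of_nonneg_left h (abs_nonneg _)) (hν u hu)
    _ = θ₂ * (ν u * (|m u - x₀ u| * ∑ v ∈ EV, (κA u v + κB u v) * q v)) := by ring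

end Nonlinear

/-! ## §4 Witnesses: one exterior, off `δ₀`, on the centred pair `½δ_h + ½δ_{−h}`, transfer `m + θv + θ₂v²` -/

section Witness

/-- **CENTRED FIBRES DO NOT CENTRE A NONLINEAR DISPLACEMENT — ATTAINED.**  One exterior at level `m`; slot off = `v = 0`, on = `v = ±h`
with probability `½` each (equal mass, equal mean: centred); nonlinear transfer `x = m + θv + θ₂v²`; test function the identity (slope
`1`, Taylor majorant `0`, critical nowhere).  The swap `E_on[g(x)] − E_off[g(x)]` is EXACTLY `θ₂h²`: first order in the curvature `θ₂`,
untouched by the matched first moment — §3's bound without criticality (`G₁θ₂·Q + G₂·M₂ = 1·θ₂·h² + 0`) is attained. [folklore] -/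
theorem centredPair_nonlinear_swap_id (m θ θ₂ h : ℝ) :
    2⁻¹ * (m + θ * h + θ₂ * h ^ 2) + 2⁻¹ * (m + θ * (-h) + θ₂ * (-h) ^ 2) - m = θ₂ * h ^ 2 := by
  ring

/-- … whereas tested on a function CRITICAL at the exterior's level, `g(x) = (x − m)²` (`g'(m) = 0`, Taylor majorant `1`), the same swap
is `θ²h² + θ₂²h⁴` — second order in `(θ, θ₂)`: the curvature enters squared once the slope at the exterior's level is gone. [folklore] -/
theorem centredPair_nonlinear_swap_sq (m θ θ₂ h : ℝ) :
    2⁻¹ * (m + θ * h + θ₂ * h ^ 2 - m) ^ 2 + 2⁻¹ * (m + θ * (-h) + θ₂ * (-h) ^ 2 - m) ^ 2 - (m - m) ^ 2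
      = θ ^ 2 * h ^ 2 + θ₂ ^ 2 * h ^ 4 := by
  ring

end Witness

end Summit.QuantumFields.BalabanUV.T4Continuum.NE1p.TiltedMeanSmoothDualCritical

end
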